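import Summits.MatrixMultiplication.MatrixMultiplication.Theorems.ObstructionDescentCornerOddLevel

set_option linter.dupNamespace false

/-!
# Obstruction descent, part R — level 1 is empty: no linear-level vectors at any block format `N ≥ 2`

`route-MatrixMultiplication-ObstructionDescent`, aside `InvariantSaturation` (stmt 32282); decomp-mm lens-3, NODE-g15.

The odd-level pair law (parts K–P) at level `k = 1` has NO rank hypothesis: `(k−1)(r−1) < k(N−1)` reads `0 < N−1`.
Hence every weight vector of type `((1^N))³` (degree `N`, the would-be `SL_N³`-invariants of degree `N` of
`ℂ^N⊗ℂ^N⊗ℂ^N`, classically `g((1^N),(1^N),(1^N)) = [sgn ⊗ sgn ⊗ sgn : triv] = 0`) vanishes at EVERY tensor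
(`evalT_eq_zero_of_level_one`, every tensor has finite rank), so it is zero: `1 ∈ emptyLevels m N` for all
`2 ≤ N ≤ m` (`one_mem_emptyLevels`), and `1 ∉ passLevels m N`, `1 ∉ pointLevels N t`.  The bottom row of the
invariant tower is empty from column `2` on.

[cite: BurgisserIkenmeyer2011, §3.1–3.2], [cite: BurgisserIkenmeyer2017, §5 (5.2), Thm 5.3], [cite: LandsbergGCT2017, §8.3.4].
-/

noncomputable section

open scoped BigOperators
open Finset

namespace Summit.MatrixMultiplication.MatrixMultiplication.Theorems.ObstructionCalculus

open Literature.Computability.AlgebraicComplexity (tensorRank tensorRank_le_card)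

section LevelOne

/-- **Level-1 vectors vanish identically** (corner type `rectType m N 1`, `2 ≤ N ≤ m`): the pair law at `k = 1` has no
rank hypothesis. [this node] -/
theorem evalT_eq_zero_of_level_one {m N : ℕ} (hN : 2 ≤ N) (hNm : N ≤ m) {F : MvPolynomial (Idx m) ℂ}
    (hF : F ∈ hwvSpace (rectType m N 1) (1 * N)) (t : Tensor ℂ m) : evalT t F = 0 :=
  evalT_eq_zero_of_odd_level_corner odd_one hN hNm hF (r := tensorRank t) (by omega) le_rfl

/-- **Level 1 is empty at every block format `N ≥ 2`:** `1 ∈ emptyLevels m N` for `2 ≤ N ≤ m`. [this node] -/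
theorem one_mem_emptyLevels {m N : ℕ} (hN : 2 ≤ N) (hNm : N ≤ m) : 1 ∈ emptyLevels m N := by
  show hwvSpace (rectType m N 1) (1 * N) = ⊥
  rw [Submodule.eq_bot_iff]
  intro F hF
  apply MvPolynomial.funext
  intro v
  have h := evalT_eq_zero_of_level_one hN hNm hF fun a b c => v (a, b, c)
  rw [evalT, MvPolynomial.aeval_eq_eval] at h
  rw [map_zero]
  simpa only [Prod.mk.eta] using h

/-- Level 1 is empty at the full format `m ≥ 2`. [this node] -/
theorem one_mem_emptyLevels_self {m : ℕ} (hm : 2 ≤ m) : 1 ∈ emptyLevels m m :=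
  one_mem_emptyLevels hm le_rfl

/-- Level 1 does not pass (`2 ≤ N ≤ m`). [this node] -/
theorem one_not_mem_passLevels {m N : ℕ} (hN : 2 ≤ N) (hNm : N ≤ m) : 1 ∉ passLevels m N := by
  intro h
  apply h
  have hbot : hwvSpace (rectType m N 1) (1 * N) = ⊥ := one_mem_emptyLevels hN hNm
  rw [hbot]
  exact bot_le

/-- Level 1 is not a level of any point (`2 ≤ N ≤ m`). [this node] -/
theorem one_not_mem_pointLevels {m N : ℕ} (hN : 2 ≤ N) (hNm : N ≤ m) (t : Tensor ℂ m) : 1 ∉ pointLevels N t := by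
  rintro ⟨F, hF, hne⟩
  exact hne (evalT_eq_zero_of_level_one hN hNm hF t)

end LevelOne

end Summit.MatrixMultiplication.MatrixMultiplication.Theorems.ObstructionCalculus

end
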